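import Literature.Topology.FourManifolds.FibrewiseMorseFrame
import Literature.Analysis.Calculus.FibredInverse
import Mathlib.Analysis.SpecialFunctions.Trigonometric.ArctanDeriv
import Mathlib.Analysis.SpecialFunctions.SmoothTransition
import Mathlib.Analysis.InnerProductSpace.Calculus
import HarnessLib

/-!
# Straightening the longitude along a periodic tube

Topic `Literature/Topology/FourManifolds`, analytic core of the *longitude-adapted tube* along
the round circle of a broken Lefschetz fibration (consumer: the Morse–Bott tube files of the
frame cluster `FibrewiseMorseFrame*.lean`).  Along a `1`-periodic tube `ℝ × F → X` around an
embedded circle which the fibration `f` maps onto the equator of `S²` by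
`t ↦ (cos 2πt, sin 2πt, 0)`, the first two coordinates `P₀, P₁` of `f` are `1`-periodic `C^∞`
functions on `ℝ × F` with `P₀ (t, 0) = cos 2πt`, `P₁ (t, 0) = sin 2πt`.  The longitude
of `f` then differs from `2πt` by a smooth *defect* `arctan (h₂/h₁)` (`h = R_{-2πt} (P₀, P₁)`)
vanishing on the zero section, and solving `t + defect/2π = s` for `t` (global fibred inversion,
`Literature.Analysis.Calculus.exists_contDiff_fibredInverse`, after a cut-off in the fibre)
reparametrises the tube so that the longitude of `f` IS the tube parameter:

* `RoundTube.cos_add_arctan_mul_sqrt`, `RoundTube.sin_add_arctan_mul_sqrt` — the polar-angle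
  identities `cos (α + arctan (h₂/h₁)) √(h₁² + h₂²) = cos α h₁ - sin α h₂` (and `sin`), `h₁ > 0`.
* `RoundTube.exists_longitude_straightening` — **main result**: `C^∞` functions `τ, Λ` on
  `ℝ × F`, inverse to each other in the first variable (`Λ (τ (s, x), x) = s`,
  `τ (Λ (t, x), x) = t`), `1`-equivariant, `τ (s, 0) = s`, such that for `‖x‖ < r` the point
  `(P₀, P₁)` at `(τ (s, x), x)` is the positive multiple `√(P₀² + P₁²) (cos 2πs, sin 2πs)` of
  `(cos 2πs, sin 2πs)`.

Everything here is **proved**; no definition, no named fact.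

## References

* J. Dieudonné, *Foundations of Modern Analysis* (1960), Ch. X §2, (10.2.5). [Dieudonne1960]
* M. W. Hirsch, *Differential Topology*, GTM 33 (1976), Ch. 4 §5 (tubular neighbourhoods).
  [HirschDT1976]
-/

noncomputable section

open Set Function Filter Metric Real
open scoped Topology ContDiff

namespace Literature.Topology.FourManifolds

namespace RoundTube

/-! ### Polar angles -/

/-- `cos (α + arctan (h₂/h₁)) · √(h₁² + h₂²) = cos α · h₁ - sin α · h₂` for `h₁ > 0`: the
vector `(h₁, h₂)` has polar angle `arctan (h₂/h₁)`. [folklore] -/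
theorem cos_add_arctan_mul_sqrt {h₁ : ℝ} (hh : 0 < h₁) (h₂ α : ℝ) :
    Real.cos (α + Real.arctan (h₂ / h₁)) * √(h₁ ^ 2 + h₂ ^ 2) =
      Real.cos α * h₁ - Real.sin α * h₂ := by
  have hR : 0 < √(h₁ ^ 2 + h₂ ^ 2) := Real.sqrt_pos.2 (by positivity)
  have hsq : 1 + (h₂ / h₁) ^ 2 = (√(h₁ ^ 2 + h₂ ^ 2) / h₁) ^ 2 := by
    rw [div_pow, div_pow, Real.sq_sqrt (by positivity)]
    field_simp
  have hroot : √(1 + (h₂ / h₁) ^ 2) = √(h₁ ^ 2 + h₂ ^ 2) / h₁ := by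
    rw [hsq, Real.sqrt_sq (by positivity)]
  rw [Real.cos_add, Real.cos_arctan, Real.sin_arctan, hroot]
  field_simp

/-- `sin (α + arctan (h₂/h₁)) · √(h₁² + h₂²) = sin α · h₁ + cos α · h₂` for `h₁ > 0`.
[folklore] -/
theorem sin_add_arctan_mul_sqrt {h₁ : ℝ} (hh : 0 < h₁) (h₂ α : ℝ) :
    Real.sin (α + Real.arctan (h₂ / h₁)) * √(h₁ ^ 2 + h₂ ^ 2) =
      Real.sin α * h₁ + Real.cos α * h₂ := by
  have hR : 0 < √(h₁ ^ 2 + h₂ ^ 2) := Real.sqrt_pos.2 (by positivity)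
  have hsq : 1 + (h₂ / h₁) ^ 2 = (√(h₁ ^ 2 + h₂ ^ 2) / h₁) ^ 2 := by
    rw [div_pow, div_pow, Real.sq_sqrt (by positivity)]
    field_simp
  have hroot : √(1 + (h₂ / h₁) ^ 2) = √(h₁ ^ 2 + h₂ ^ 2) / h₁ := by
    rw [hsq, Real.sqrt_sq (by positivity)]
  rw [Real.sin_add, Real.cos_arctan, Real.sin_arctan, hroot]
  field_simp

/-! ### The straightening -/

variable {F : Type*} [NormedAddCommGroup F] [InnerProductSpace ℝ F] [CompleteSpace F]

/-- **Straightening the longitude along a periodic tube.**  Let `P₀, P₁ : ℝ × F → ℝ` be `C^∞`,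
`1`-periodic in `t`, with `P₀ (t, 0) = cos 2πt`, `P₁ (t, 0) = sin 2πt`.  Then there are `C^∞`
functions `τ, Λ : ℝ × F → ℝ` and `r > 0` with `Λ (τ (s, x), x) = s`, `τ (Λ (t, x), x) = t`,
`τ (s + 1, x) = τ (s, x) + 1`, `τ (s, 0) = s`, and, for `‖x‖ < r`,
`(P₀, P₁) (τ (s, x), x) = √(P₀² + P₁²) · (cos 2πs, sin 2πs)` with `P₀² + P₁² > 0` there.
Construction: `Λ (t, x) = t + χ(x) · arctan (h₂/h₁)/2π` with
`h₁ = cos 2πt P₀ + sin 2πt P₁`, `h₂ = -sin 2πt P₀ + cos 2πt P₁` (so `h (t, 0) = (1, 0)`) and a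
cut-off `χ` supported where `h₁ > 1/2` and `|∂ₜ (arctan (h₂/h₁)/2π)| < 1/4`; `τ` is the fibred
inverse of `Λ` (`Literature.Analysis.Calculus.exists_contDiff_fibredInverse`).
[cite: Dieudonne1960, Ch. X §2, (10.2.5)] -/
theorem exists_longitude_straightening {P₀ P₁ : ℝ × F → ℝ} (hP₀ : ContDiff ℝ ∞ P₀)
    (hP₁ : ContDiff ℝ ∞ P₁) (hT₀ : ∀ (t : ℝ) (x : F), P₀ (t + 1, x) = P₀ (t, x))
    (hT₁ : ∀ (t : ℝ) (x : F), P₁ (t + 1, x) = P₁ (t, x))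
    (h0₀ : ∀ t : ℝ, P₀ (t, 0) = Real.cos (2 * π * t))
    (h0₁ : ∀ t : ℝ, P₁ (t, 0) = Real.sin (2 * π * t)) :
    ∃ (τ Λ : ℝ × F → ℝ) (r : ℝ), ContDiff ℝ ∞ τ ∧ ContDiff ℝ ∞ Λ ∧ 0 < r ∧
      (∀ (s : ℝ) (x : F), Λ (τ (s, x), x) = s) ∧ (∀ (t : ℝ) (x : F), τ (Λ (t, x), x) = t) ∧
      (∀ (s : ℝ) (x : F), τ (s + 1, x) = τ (s, x) + 1) ∧ (∀ s : ℝ, τ (s, 0) = s) ∧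
      ∀ (s : ℝ) (x : F), ‖x‖ < r →
        P₀ (τ (s, x), x) =
            √(P₀ (τ (s, x), x) ^ 2 + P₁ (τ (s, x), x) ^ 2) * Real.cos (2 * π * s) ∧
          P₁ (τ (s, x), x) =
            √(P₀ (τ (s, x), x) ^ 2 + P₁ (τ (s, x), x) ^ 2) * Real.sin (2 * π * s) ∧
          0 < P₀ (τ (s, x), x) ^ 2 + P₁ (τ (s, x), x) ^ 2 := by
  -- the rotated horizontal part `h = R_{-2πt} (P₀, P₁)`
  obtain ⟨h₁, hh₁⟩ : ∃ h₁ : ℝ × F → ℝ, ∀ q,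
      h₁ q = Real.cos (2 * π * q.1) * P₀ q + Real.sin (2 * π * q.1) * P₁ q := ⟨_, fun q => rfl⟩
  obtain ⟨h₂, hh₂⟩ : ∃ h₂ : ℝ × F → ℝ, ∀ q,
      h₂ q = -Real.sin (2 * π * q.1) * P₀ q + Real.cos (2 * π * q.1) * P₁ q :=
    ⟨_, fun q => rfl⟩
  have hcs : ContDiff ℝ ∞ fun q : ℝ × F => Real.cos (2 * π * q.1) :=
    Real.contDiff_cos.comp (contDiff_const.mul contDiff_fst)
  have hss : ContDiff ℝ ∞ fun q : ℝ × F => Real.sin (2 * π * q.1) :=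
    Real.contDiff_sin.comp (contDiff_const.mul contDiff_fst)
  have hh₁s : ContDiff ℝ ∞ h₁ := by
    rw [show h₁ = _ from funext hh₁]
    exact (hcs.mul hP₀).add (hss.mul hP₁)
  have hh₂s : ContDiff ℝ ∞ h₂ := by
    rw [show h₂ = _ from funext hh₂]
    exact (hss.neg.mul hP₀).add (hcs.mul hP₁)
  have hh₁0 : ∀ t : ℝ, h₁ (t, 0) = 1 := fun t => by
    rw [hh₁, h0₀, h0₁]
    linear_combination Real.cos_sq_add_sin_sq (2 * π * t)
  have hh₂0 : ∀ t : ℝ, h₂ (t, 0) = 0 := fun t => by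
    rw [hh₂, h0₀, h0₁]
    ring
  have hsum : ∀ q, h₁ q ^ 2 + h₂ q ^ 2 = P₀ q ^ 2 + P₁ q ^ 2 := fun q => by
    rw [hh₁, hh₂]
    linear_combination (P₀ q ^ 2 + P₁ q ^ 2) * Real.cos_sq_add_sin_sq (2 * π * q.1)
  have hP₀h : ∀ q, Real.cos (2 * π * q.1) * h₁ q - Real.sin (2 * π * q.1) * h₂ q = P₀ q :=
    fun q => by
      rw [hh₁, hh₂]
      linear_combination P₀ q * Real.cos_sq_add_sin_sq (2 * π * q.1)
  have hP₁h : ∀ q, Real.sin (2 * π * q.1) * h₁ q + Real.cos (2 * π * q.1) * h₂ q = P₁ q :=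
    fun q => by
      rw [hh₁, hh₂]
      linear_combination P₁ q * Real.cos_sq_add_sin_sq (2 * π * q.1)
  -- periodicity
  have h2π : ∀ t : ℝ, 2 * π * (t + 1) = 2 * π * t + 2 * π := fun t => by ring
  have hh₁T : ∀ (t : ℝ) (x : F), h₁ (t + 1, x) = h₁ (t, x) := fun t x => by
    rw [hh₁, hh₁]
    simp only [h2π, Real.cos_add_two_pi, Real.sin_add_two_pi, hT₀, hT₁]
  have hh₂T : ∀ (t : ℝ) (x : F), h₂ (t + 1, x) = h₂ (t, x) := fun t x => by
    rw [hh₂, hh₂]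
    simp only [h2π, Real.cos_add_two_pi, Real.sin_add_two_pi, hT₀, hT₁]
  -- the defect `δ = arctan (h₂/h₁) / 2π`, smooth where `h₁ > 1/2`
  obtain ⟨δ, hδ⟩ : ∃ δ : ℝ × F → ℝ, ∀ q, δ q = (2 * π)⁻¹ * Real.arctan (h₂ q / h₁ q) :=
    ⟨_, fun q => rfl⟩
  have hWo : IsOpen {q : ℝ × F | 1 / 2 < h₁ q} := isOpen_lt continuous_const hh₁s.continuous
  have hW0 : ∀ t : ℝ, ((t, (0 : F)) : ℝ × F) ∈ {q : ℝ × F | 1 / 2 < h₁ q} := fun t => by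
    show 1 / 2 < h₁ (t, 0)
    rw [hh₁0]
    norm_num
  have hδs : ContDiffOn ℝ ∞ δ {q : ℝ × F | 1 / 2 < h₁ q} := by
    rw [show δ = _ from funext hδ]
    exact contDiffOn_const.mul (Real.contDiff_arctan.comp_contDiffOn
      (hh₂s.contDiffOn.div hh₁s.contDiffOn fun q hq => by
        have hq' : 1 / 2 < h₁ q := hq
        exact ne_of_gt (by linarith)))
  have hδ0 : ∀ t : ℝ, δ (t, 0) = 0 := fun t => by
    rw [hδ, hh₂0, zero_div, Real.arctan_zero, mul_zero]
  have hδT : ∀ (t : ℝ) (x : F), δ (t + 1, x) = δ (t, x) := fun t x => by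
    rw [hδ, hδ, hh₁T, hh₂T]
  -- its `t`-derivative `D`, continuous, vanishing on the zero section, periodic
  obtain ⟨D, hD⟩ : ∃ D : ℝ × F → ℝ, ∀ q, D q = fderiv ℝ δ q (1, 0) := ⟨_, fun q => rfl⟩
  have hDc : ContinuousOn D {q : ℝ × F | 1 / 2 < h₁ q} := by
    rw [show D = _ from funext hD]
    exact (hδs.continuousOn_fderiv_of_isOpen hWo (by simp)).clm_apply continuousOn_const
  have hD0 : ∀ t : ℝ, D (t, 0) = 0 := fun t => by
    rw [hD]
    have hdiff : DifferentiableAt ℝ δ (t, 0) :=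
      (hδs.contDiffAt (hWo.mem_nhds (hW0 t))).differentiableAt (by simp)
    have h1 : HasDerivAt (fun t : ℝ => δ (t, 0)) (fderiv ℝ δ (t, 0) (1, 0)) t :=
      hdiff.hasFDerivAt.comp_hasDerivAt t ((hasDerivAt_id t).prodMk (hasDerivAt_const t (0 : F)))
    have h2 : HasDerivAt (fun t : ℝ => δ (t, 0)) 0 t := by
      rw [show (fun t : ℝ => δ (t, 0)) = fun _ => 0 from funext hδ0]
      exact hasDerivAt_const t 0
    exact h1.unique h2
  have hDT : ∀ (t : ℝ) (x : F), D (t + 1, x) = D (t, x) := fun t x => by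
    rw [hD, hD]
    have hfun : (fun q : ℝ × F => δ (q + (1, 0))) = δ := funext fun q => by
      obtain ⟨a, v⟩ := q
      show δ (a + 1, v + 0) = δ (a, v)
      rw [add_zero, hδT]
    have h : fderiv ℝ δ (t + 1, x) = fderiv ℝ δ (t, x) := by
      have e : ((t + 1, x) : ℝ × F) = (t, x) + (1, 0) := by rw [Prod.mk_add_mk, add_zero]
      rw [e, ← fderiv_comp_add_right ((1 : ℝ), (0 : F)), hfun]
    rw [h]
  -- a uniform good tube `ℝ × B(0, r₁)`: `h₁ > 1/2` and `|D| < 1/4`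
  have hW'o : IsOpen {q ∈ {q : ℝ × F | 1 / 2 < h₁ q} | |D q| < 1 / 4} :=
    (continuous_abs.comp_continuousOn hDc).isOpen_inter_preimage hWo isOpen_Iio
  obtain ⟨r₁, hr₁, hball⟩ := exists_ball_subset_of_forall_add
    (W := {q ∈ {q : ℝ × F | 1 / 2 < h₁ q} | |D q| < 1 / 4}) hW'o
    (fun t => ⟨hW0 t, by show |D (t, 0)| < 1 / 4; rw [hD0, abs_zero]; norm_num⟩) one_pos
    (fun t u hq => ⟨by show 1 / 2 < h₁ (t + 1, u); rw [hh₁T]; exact hq.1,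
      by show |D (t + 1, u)| < 1 / 4; rw [hDT]; exact hq.2⟩)
    (fun t u hq => ⟨by
        show 1 / 2 < h₁ (t - 1, u); rw [← hh₁T, sub_add_cancel]; exact hq.1,
      by show |D (t - 1, u)| < 1 / 4; rw [← hDT, sub_add_cancel]; exact hq.2⟩)
  have hgood : ∀ q : ℝ × F, ‖q.2‖ < r₁ → 1 / 2 < h₁ q ∧ |D q| < 1 / 4 := fun q hq =>
    hball q.1 q.2 (mem_ball_zero_iff.2 hq)
  -- the cut-off `χ`: `1` on `B(0, r₁/2)`, `0` outside `B(0, 3r₁/4)`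
  obtain ⟨χ, hχ⟩ : ∃ χ : F → ℝ, ∀ x, χ x = Real.smoothTransition (2 - 4 * ‖x‖ ^ 2 / r₁ ^ 2) :=
    ⟨_, fun x => rfl⟩
  have hχs : ContDiff ℝ ∞ χ := by
    rw [show χ = _ from funext hχ]
    exact Real.smoothTransition.contDiff.comp
      (contDiff_const.sub ((contDiff_const.mul (contDiff_norm_sq ℝ)).div_const _))
  have hχ1 : ∀ x : F, ‖x‖ < r₁ / 2 → χ x = 1 := fun x hx => by
    rw [hχ]
    refine Real.smoothTransition.one_of_one_le ?_
    have h4 : 4 * ‖x‖ ^ 2 / r₁ ^ 2 < 1 := by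
      rw [div_lt_one (by positivity)]
      nlinarith [norm_nonneg x]
    linarith
  have hχ0 : ∀ x : F, 3 * r₁ / 4 ≤ ‖x‖ → χ x = 0 := fun x hx => by
    rw [hχ]
    refine Real.smoothTransition.zero_of_nonpos ?_
    have h4 : 2 ≤ 4 * ‖x‖ ^ 2 / r₁ ^ 2 := by
      rw [le_div_iff₀ (by positivity)]
      nlinarith [norm_nonneg x]
    linarith
  have hχnn : ∀ x, 0 ≤ χ x := fun x => by rw [hχ]; exact Real.smoothTransition.nonneg _
  have hχle : ∀ x, χ x ≤ 1 := fun x => by rw [hχ]; exact Real.smoothTransition.le_one _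
  have hχz : χ 0 = 1 := hχ1 0 (by rw [norm_zero]; positivity)
  -- `Λ (t, x) = t + χ x · δ (t, x)`
  obtain ⟨Λ, hΛ⟩ : ∃ Λ : ℝ × F → ℝ, ∀ q, Λ q = q.1 + χ q.2 * δ q := ⟨_, fun q => rfl⟩
  have hO₁ : IsOpen {q : ℝ × F | ‖q.2‖ < r₁} :=
    isOpen_lt (continuous_norm.comp continuous_snd) continuous_const
  have hO₂ : IsOpen {q : ℝ × F | 3 * r₁ / 4 < ‖q.2‖} :=
    isOpen_lt continuous_const (continuous_norm.comp continuous_snd)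
  have hcover : ∀ q : ℝ × F, ‖q.2‖ < r₁ ∨ 3 * r₁ / 4 < ‖q.2‖ := fun q => by
    rcases lt_or_ge ‖q.2‖ r₁ with h | h
    · exact Or.inl h
    · exact Or.inr (by linarith)
  have hΛs₁ : ContDiffOn ℝ ∞ Λ {q : ℝ × F | ‖q.2‖ < r₁} := by
    rw [show Λ = _ from funext hΛ]
    exact contDiffOn_fst.add (((hχs.comp contDiff_snd).contDiffOn).mul
      (hδs.mono fun q hq => (hgood q hq).1))
  have hΛfst : ∀ q : ℝ × F, 3 * r₁ / 4 < ‖q.2‖ → Λ q = q.1 := fun q hq => by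
    rw [hΛ, hχ0 q.2 hq.le, zero_mul, add_zero]
  have hΛs₂ : ContDiffOn ℝ ∞ Λ {q : ℝ × F | 3 * r₁ / 4 < ‖q.2‖} :=
    contDiffOn_fst.congr fun q hq => hΛfst q hq
  have hΛs : ContDiff ℝ ∞ Λ := contDiff_iff_contDiffAt.2 fun q => by
    rcases hcover q with h | h
    · exact hΛs₁.contDiffAt (hO₁.mem_nhds h)
    · exact hΛs₂.contDiffAt (hO₂.mem_nhds h)
  -- `∂ₜ Λ ≥ 1/2`
  have hΛder : ∀ q : ℝ × F, (1 / 2 : ℝ) ≤ fderiv ℝ Λ q (1, 0) := fun q => by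
    rcases hcover q with h | h
    · obtain ⟨hqW, hqD⟩ := hgood q h
      have hδd : HasFDerivAt δ (fderiv ℝ δ q) q :=
        ((hδs.contDiffAt (hWo.mem_nhds hqW)).differentiableAt (by simp)).hasFDerivAt
      have hχd : HasFDerivAt (fun q : ℝ × F => χ q.2)
          ((fderiv ℝ χ q.2).comp (ContinuousLinearMap.snd ℝ ℝ F)) q :=
        (hχs.differentiable (by simp) q.2).hasFDerivAt.comp q hasFDerivAt_snd
      have hΛd : HasFDerivAt Λ (ContinuousLinearMap.fst ℝ ℝ F +
          (χ q.2 • fderiv ℝ δ q + δ q • (fderiv ℝ χ q.2).comp (ContinuousLinearMap.snd ℝ ℝ F)))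
          q := by
        rw [show Λ = _ from funext hΛ]
        exact hasFDerivAt_fst.add (hχd.mul hδd)
      rw [hΛd.fderiv]
      simp only [add_apply, smul_apply, ContinuousLinearMap.coe_fst',
        ContinuousLinearMap.comp_apply, ContinuousLinearMap.coe_snd', map_zero, smul_eq_mul,
        mul_zero, add_zero, ← hD]
      have hlo : -(1 / 4) < D q := (abs_lt.1 hqD).1
      nlinarith [hχnn q.2, hχle q.2, mul_le_mul_of_nonneg_left hlo.le (hχnn q.2)]
    · have heq : Λ =ᶠ[𝓝 q] fun q : ℝ × F => q.1 := by
        filter_upwards [hO₂.mem_nhds h] with q' hq'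
        exact hΛfst q' hq'
      rw [heq.fderiv_eq, fderiv_fst]
      simp only [ContinuousLinearMap.coe_fst']
      norm_num
  -- periodicity of `Λ` and the fibred inverse `τ`
  have hΛT : ∀ (t : ℝ) (x : F), Λ (t + 1, x) = Λ (t, x) + 1 := fun t x => by
    rw [hΛ, hΛ]
    simp only [hδT]
    ring
  obtain ⟨τ, hτs, hΛτ, hτΛ⟩ := Literature.Analysis.Calculus.exists_contDiff_fibredInverse hΛs hΛder
  have hτT : ∀ (s : ℝ) (x : F), τ (s + 1, x) = τ (s, x) + 1 :=
    Literature.Analysis.Calculus.fibredInverse_add hΛτ hτΛ hΛT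
  have hτ0 : ∀ s : ℝ, τ (s, 0) = s := fun s => by
    have hΛ0 : Λ (s, 0) = s := by rw [hΛ]; simp [hδ0]
    have h := hτΛ s 0
    rwa [hΛ0] at h
  refine ⟨τ, Λ, r₁ / 2, hτs, hΛs, by positivity, hΛτ, hτΛ, hτT, hτ0, fun s x hx => ?_⟩
  -- the longitude identity for `‖x‖ < r₁ / 2`
  have hx' : ‖x‖ < r₁ := by linarith
  obtain ⟨hqW, -⟩ := hgood (τ (s, x), x) hx'
  have hh₁pos : 0 < h₁ (τ (s, x), x) := by
    have h : 1 / 2 < h₁ (τ (s, x), x) := hqW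
    linarith
  have hangle :
      2 * π * s = 2 * π * τ (s, x) + Real.arctan (h₂ (τ (s, x), x) / h₁ (τ (s, x), x)) := by
    have h := hΛτ s x
    rw [hΛ] at h
    simp only [hχ1 x hx, one_mul, hδ] at h
    have hπ : (2 * π : ℝ) ≠ 0 := by positivity
    calc 2 * π * s = 2 * π * (τ (s, x) +
          (2 * π)⁻¹ * Real.arctan (h₂ (τ (s, x), x) / h₁ (τ (s, x), x))) := by rw [h]
      _ = 2 * π * τ (s, x) + Real.arctan (h₂ (τ (s, x), x) / h₁ (τ (s, x), x)) := by
          rw [mul_add, mul_inv_cancel_left₀ hπ]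
  have hsq : 0 < h₁ (τ (s, x), x) ^ 2 + h₂ (τ (s, x), x) ^ 2 := by positivity
  refine ⟨?_, ?_, by rw [← hsum]; exact hsq⟩
  · calc P₀ (τ (s, x), x)
        = Real.cos (2 * π * τ (s, x)) * h₁ (τ (s, x), x) -
            Real.sin (2 * π * τ (s, x)) * h₂ (τ (s, x), x) := (hP₀h _).symm
      _ = Real.cos (2 * π * s) * √(h₁ (τ (s, x), x) ^ 2 + h₂ (τ (s, x), x) ^ 2) := by
          rw [hangle, cos_add_arctan_mul_sqrt hh₁pos]
      _ = √(P₀ (τ (s, x), x) ^ 2 + P₁ (τ (s, x), x) ^ 2) * Real.cos (2 * π * s) := by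
          rw [hsum, mul_comm]
  · calc P₁ (τ (s, x), x)
        = Real.sin (2 * π * τ (s, x)) * h₁ (τ (s, x), x) +
            Real.cos (2 * π * τ (s, x)) * h₂ (τ (s, x), x) := (hP₁h _).symm
      _ = Real.sin (2 * π * s) * √(h₁ (τ (s, x), x) ^ 2 + h₂ (τ (s, x), x) ^ 2) := by
          rw [hangle, sin_add_arctan_mul_sqrt hh₁pos]
      _ = √(P₀ (τ (s, x), x) ^ 2 + P₁ (τ (s, x), x) ^ 2) * Real.sin (2 * π * s) := by
          rw [hsum, mul_comm]

end RoundTube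

end Literature.Topology.FourManifolds
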